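import Summits.AtomisticToContinuum.Crystallization.Theorems.FrustratedLawDichotomyStrainedPatchHomTermEvalPoint

/-!
# TABLE-DRIVEN ℕ-encoded (P4) fcc Gram-leaf checker `leafCheck` (v2; critic rows 799 (c) / 803 / 806 (2)(B), style condition (viii))

decomp-a2c hand-1 g20 (crux `AperiodicFrustratedLawGap`, stmt-AtomisticToContinuum-27623).  DEFINITIONS ONLY (computable; no `noncomputable`,
no instances, no notation): the data formats and the kernel-evaluated functions of the v2 leaf checker whose SEMANTICS is
`…HomLeafPoints.boxSum_ge_of_nearPoints` (soundness theorem: companion module).  Design (KERNEL-COST-g20.md, 2.4 μs per ℕ-primitive op):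

* `Row` — one row of the once-certified `q`-table: grid point `t`, sign–magnitude value bound `±aV ≤ SC·φ(t/SC)`, sign–magnitude derivative
  midpoint `±aD` with `SC·φ′(t/SC) ∈ [±aD − E, ±aD + E]` for a GLOBAL half-width `E`, curvature constant `M` valid on `[A, B] ∋ t`
  (`φ′ + (M/SC)·id` monotone on `[A/SC, B/SC]`).  `Row.ok E` re-checks a row with the EXISTING reflected checks `valLoOK` / `derivOK` / `curvOK`
  (run ONCE per row when the table is certified; never per leaf).  Rows are self-contained: table validity is `QT.allOK` (every row ok) — the
  search-tree ordering is irrelevant to soundness.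
* `QT` — the table as a static binary search tree keyed by `t`; `QT.findLE q` returns SOME row met on the descent (the checker re-checks `t ≤ q`
  and the range inclusion, so ANY returned row is sound to use).
* `NL` — a near-label record: the label `b ∈ [−7,7]³` and the precomputed magnitudes `m_ij = |bᵢ bⱼ|` with the three off-diagonal sign bits
  (`NL.ok` re-derives them from `b`; checked once over the literal list).
* `GB` — a Gram-coordinate leaf box: centre `c0ₖ ≥ 0` and half-width `wₖ` for the 9 coordinates `k = (i, j)`, all at scale `SC = 2^48`.
* `Acc` / `step` / `foldNL` / `leafCheck` — the per-label fold in ℕ with sign-split accumulators (value `vP/vN`, first-order centre correction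
  `dP/dN`, `Σδ`, six gradient classes `gⱼP/gⱼN`, curvature `cur`), `Nat.*` primitives and `match` on `Bool` only, no `let`; the final inequality is
  the points-form checker inequality multiplied through by `SC³` (module docstring of the soundness file gives the bookkeeping).

`--supports stmt-AtomisticToContinuum-27623`.
-/

namespace Summit.AtomisticToContinuum.Crystallization.Theorems.FrustratedLawDichotomyStrainedPatchHomLeafTableCheck

open Literature.Analysis.ValidatedNumerics.Numerics (SC FI)
open Summit.AtomisticToContinuum.Crystallization.Theorems.FrustratedLawDichotomyStrainedPatchHomTermEval (curvOK eWin)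
open Summit.AtomisticToContinuum.Crystallization.Theorems.FrustratedLawDichotomyStrainedPatchHomTermEvalPoint (valLoOK derivOK eWinVal eWinDer)

/-! ## §1. The `q`-table -/

/-- One table row (naturals; signs as separate bits).  To keep the literal table small the grid point and the curvature range are stored
in units of `2^32`: `t = 2^32·ti`, `A = t − 2^32·dA`, `B = t + 2^32·dB` (all at scale `SC = 2^48`; the literal is the FIRST factor so that
symbolic reduction never unfolds it). -/
structure Row where
  /-- grid point in units of `2^32` -/
  ti : ℕ
  /-- sign bit of the value bound (`true` = negative) -/
  sV : Bool
  /-- magnitude of the value bound (scale `SC`) -/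
  aV : ℕ
  /-- sign bit of the derivative midpoint -/
  sD : Bool
  /-- magnitude of the derivative midpoint (scale `SC`) -/
  aD : ℕ
  /-- curvature constant on `[A, B]` (scale `SC`) -/
  M : ℕ
  /-- `(t − A) / 2^32` -/
  dA : ℕ
  /-- `(B − t) / 2^32` -/
  dB : ℕ
  /-- window mode only: the EXACT scaled square root of `t` (`s·s = t·SC`); `0` otherwise -/
  s : ℕ

/-- The storage unit `2^32`. -/
def U32 : ℕ := 4294967296

/-- The grid point `t` (scale `SC`). -/
def Row.t (r : Row) : ℕ := Nat.mul U32 r.ti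

/-- Left end `A` of the curvature range (scale `SC`). -/
def Row.A (r : Row) : ℕ := Nat.sub (Nat.mul U32 r.ti) (Nat.mul U32 r.dA)

/-- Right end `B` of the curvature range (scale `SC`). -/
def Row.B (r : Row) : ℕ := Nat.add (Nat.mul U32 r.ti) (Nat.mul U32 r.dB)

/-- Sign–magnitude to `ℤ`. -/
def sgnZ (s : Bool) (a : ℕ) : ℤ :=
  match s with
  | true => -(a : ℤ)
  | false => (a : ℤ)

/-- `SC = 2^48` as a natural-number literal. -/
def SCN : ℕ := 281474976710656

/-- `2^42` (four steps of the window zone's root grid `1/256`, scaled). -/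
def U42 : ℕ := 4398046511104

/-- GENERIC row certification by the existing reflected checks `valLoOK` / `derivOK` / `curvOK` (fine for `B < 16·SC`; beyond that the Literature
`FI.sqrt` upper end is loose and the checks cannot pass). -/
def Row.okGen (E : ℕ) (r : Row) : Bool :=
  valLoOK (r.t : ℤ) (sgnZ r.sV r.aV) && derivOK (r.t : ℤ) (sgnZ r.sD r.aD - (E : ℤ)) (sgnZ r.sD r.aD + (E : ℤ)) &&
    curvOK (r.A : ℤ) (r.B : ℤ) (r.M : ℤ) && Nat.ble r.A r.t && Nat.ble r.t r.B

/-- WINDOW-MODE row certification (`9·SC ≤ A ≤ t ≤ B`, `t ≤ 81/4·SC`) with the EXACT root `s` of `t` and the roots `s ∓ 2^42` bracketing `A`, `B`: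
the window enclosures `eWinVal` / `eWinDer` / `eWin` are evaluated at these roots directly (no `FI.sqrt`); if `B` exceeds `81/4` the curvature range is
glued with the far regime at `9/2`. -/
def Row.okWin (E : ℕ) (r : Row) : Bool :=
  Nat.beq (Nat.mul r.s r.s) (Nat.mul r.t SCN) && Nat.ble (Nat.mul 9 SCN) r.A && Nat.ble r.A r.t && Nat.ble r.t r.B &&
    Nat.ble (Nat.mul 4 r.t) (Nat.mul 81 SCN) && Nat.blt U42 r.s &&
    Nat.ble (Nat.mul (Nat.sub r.s U42) (Nat.sub r.s U42)) (Nat.mul r.A SCN) &&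
    decide (sgnZ r.sV r.aV ≤ (eWinVal (FI.ofScaled (r.t : ℤ)) (r.s : ℤ)).lo) &&
    decide (sgnZ r.sD r.aD - (E : ℤ) ≤ (eWinDer (r.s : ℤ) (r.s : ℤ)).lo) && decide ((eWinDer (r.s : ℤ) (r.s : ℤ)).hi ≤ sgnZ r.sD r.aD + (E : ℤ)) &&
    (match Nat.ble (Nat.mul 4 r.B) (Nat.mul 81 SCN) with
      | true => Nat.ble (Nat.mul r.B SCN) (Nat.mul (Nat.add r.s U42) (Nat.add r.s U42)) &&
          decide ((eWin ((Nat.sub r.s U42 : ℕ) : ℤ) ((Nat.add r.s U42 : ℕ) : ℤ)).hi ≤ (r.M : ℤ))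
      | false => decide ((eWin ((Nat.sub r.s U42 : ℕ) : ℤ) (9 * (SC : ℤ) / 2)).hi ≤ (r.M : ℤ)))

/-- Row certification: generic or window mode. -/
def Row.ok (E : ℕ) (r : Row) : Bool := r.okGen E || r.okWin E

/-- The table: a static binary search tree keyed by `Row.t`. -/
inductive QT where
  | nil : QT
  | node : QT → Row → QT → QT

/-- Descent with best-so-far: the last row with `t ≤ q` met on the search path (or the incoming `best`). -/
def QT.findLE (q : ℕ) : QT → Option Row → Option Row
  | .nil, best => best
  | .node l r rt, best =>
    match Nat.blt q r.t with
    | true => QT.findLE q l best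
    | false => QT.findLE q rt (some r)

/-- Every row of the table passes `Row.ok E`. -/
def QT.allOK (E : ℕ) : QT → Bool
  | .nil => true
  | .node l r rt => QT.allOK E l && r.ok E && QT.allOK E rt

/-! ## §2. Near-label records -/

/-- A near-label record: the label, its fcc norm `n = Σbᵢ² + Σ_{i<j} bᵢbⱼ = ‖Σ bᵢ fᵢ‖²`, and its precomputed `|bᵢ bⱼ|` / sign data. -/
structure NL where
  /-- `‖Σ bᵢ fccVec i‖²` -/
  n : ℕ
  /-- the label -/
  b0 : ℤ
  /-- the label -/
  b1 : ℤ
  /-- the label -/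
  b2 : ℤ
  /-- `b0²` -/
  m00 : ℕ
  /-- `b1²` -/
  m11 : ℕ
  /-- `b2²` -/
  m22 : ℕ
  /-- `|b0 b1|` -/
  m01 : ℕ
  /-- `|b0 b2|` -/
  m02 : ℕ
  /-- `|b1 b2|` -/
  m12 : ℕ
  /-- `b0 b1 < 0` -/
  s01 : Bool
  /-- `b0 b2 < 0` -/
  s02 : Bool
  /-- `b1 b2 < 0` -/
  s12 : Bool

/-- Consistency of the precomputed fields with the label (checked once over the literal list). -/
def NL.ok (l : NL) : Bool :=
  decide ((l.n : ℤ) = l.b0 * l.b0 + l.b1 * l.b1 + l.b2 * l.b2 + l.b0 * l.b1 + l.b0 * l.b2 + l.b1 * l.b2) &&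
  decide ((l.m00 : ℤ) = l.b0 * l.b0) && decide ((l.m11 : ℤ) = l.b1 * l.b1) && decide ((l.m22 : ℤ) = l.b2 * l.b2) &&
    decide (sgnZ l.s01 l.m01 = l.b0 * l.b1) && decide (sgnZ l.s02 l.m02 = l.b0 * l.b2) && decide (sgnZ l.s12 l.m12 = l.b1 * l.b2)

/-! ## §3. Gram leaf boxes and per-leaf constants -/

/-- A Gram-coordinate leaf box at scale `SC`: centre `c ij` (all `≥ 0`) and half-widths `w ij`. -/
structure GB where
  /-- centre -/
  c00 : ℕ
  /-- centre -/
  c01 : ℕ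
  /-- centre -/
  c02 : ℕ
  /-- centre -/
  c10 : ℕ
  /-- centre -/
  c11 : ℕ
  /-- centre -/
  c12 : ℕ
  /-- centre -/
  c20 : ℕ
  /-- centre -/
  c21 : ℕ
  /-- centre -/
  c22 : ℕ
  /-- half-width -/
  w00 : ℕ
  /-- half-width -/
  w01 : ℕ
  /-- half-width -/
  w02 : ℕ
  /-- half-width -/
  w10 : ℕ
  /-- half-width -/
  w11 : ℕ
  /-- half-width -/
  w12 : ℕ
  /-- half-width -/
  w20 : ℕ
  /-- half-width -/
  w21 : ℕ
  /-- half-width -/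
  w22 : ℕ

/-- Per-leaf constants of the hot loop: diagonal centres/widths and the class-summed off-diagonal ones (`c01 + c10`, …). -/
structure LK where
  /-- `c00` -/
  c0 : ℕ
  /-- `c11` -/
  c1 : ℕ
  /-- `c22` -/
  c2 : ℕ
  /-- `c01 + c10` -/
  c3 : ℕ
  /-- `c02 + c20` -/
  c4 : ℕ
  /-- `c12 + c21` -/
  c5 : ℕ
  /-- `w00` -/
  w0 : ℕ
  /-- `w11` -/
  w1 : ℕ
  /-- `w22` -/
  w2 : ℕ
  /-- `w01 + w10` -/
  w3 : ℕ
  /-- `w02 + w20` -/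
  w4 : ℕ
  /-- `w12 + w21` -/
  w5 : ℕ

/-- The per-leaf constants of a box. -/
def GB.toLK (g : GB) : LK :=
  ⟨g.c00, g.c11, g.c22, Nat.add g.c01 g.c10, Nat.add g.c02 g.c20, Nat.add g.c12 g.c21,
   g.w00, g.w11, g.w22, Nat.add g.w01 g.w10, Nat.add g.w02 g.w20, Nat.add g.w12 g.w21⟩

/-! ## §4. The accumulator and the per-label step -/

/-- Fold state (all naturals; `P`/`N` = positive/negative parts). -/
structure Acc where
  /-- no range / lookup failure so far -/
  ok : Bool
  /-- `Σ V⁺` -/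
  vP : ℕ
  /-- `Σ V⁻` -/
  vN : ℕ
  /-- `Σ (D δ)⁺` -/
  dP : ℕ
  /-- `Σ (D δ)⁻` -/
  dN : ℕ
  /-- `Σ δ` -/
  sd : ℕ
  /-- gradient class `00`, positive part -/
  g0P : ℕ
  /-- gradient class `00`, negative part -/
  g0N : ℕ
  /-- class `11` -/
  g1P : ℕ
  /-- class `11` -/
  g1N : ℕ
  /-- class `22` -/
  g2P : ℕ
  /-- class `22` -/
  g2N : ℕ
  /-- class `01` -/
  g3P : ℕ
  /-- class `01` -/
  g3N : ℕ
  /-- class `02` -/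
  g4P : ℕ
  /-- class `02` -/
  g4N : ℕ
  /-- class `12` -/
  g5P : ℕ
  /-- class `12` -/
  g5N : ℕ
  /-- `Σ M (δ + r)²` -/
  cur : ℕ

/-- The empty accumulator. -/
def acc0 : Acc := ⟨true, 0, 0, 0, 0, 0, 0, 0, 0, 0, 0, 0, 0, 0, 0, 0, 0, 0, 0⟩

/-- Mark failure (fields kept). -/
def Acc.fail (a : Acc) : Acc :=
  ⟨false, a.vP, a.vN, a.dP, a.dN, a.sd, a.g0P, a.g0N, a.g1P, a.g1N, a.g2P, a.g2N, a.g3P, a.g3N, a.g4P, a.g4N, a.g5P, a.g5N, a.cur⟩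

/-- Add `x` to the positive part unless the sign bit says negative. -/
def addP (neg : Bool) (x p : ℕ) : ℕ :=
  match neg with
  | true => p
  | false => Nat.add p x

/-- Add `x` to the negative part if the sign bit says negative. -/
def addN (neg : Bool) (x n : ℕ) : ℕ :=
  match neg with
  | true => Nat.add n x
  | false => n

/-- Exclusive or of two sign bits. -/
def sx (a b : Bool) : Bool :=
  match a with
  | true => (match b with | true => false | false => true)
  | false => b

/-- Positive part of the label's centre value `q0 = Σₖ L_bk c0ₖ`. -/
def qPos (k : LK) (l : NL) : ℕ :=
  Nat.add (Nat.add (Nat.add (Nat.mul l.m00 k.c0) (Nat.mul l.m11 k.c1)) (Nat.mul l.m22 k.c2))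
    (addP l.s01 (Nat.mul l.m01 k.c3) (addP l.s02 (Nat.mul l.m02 k.c4) (addP l.s12 (Nat.mul l.m12 k.c5) 0)))

/-- Negative part of `q0`. -/
def qNeg (k : LK) (l : NL) : ℕ :=
  addN l.s01 (Nat.mul l.m01 k.c3) (addN l.s02 (Nat.mul l.m02 k.c4) (addN l.s12 (Nat.mul l.m12 k.c5) 0))

/-- The label's range radius `r = Σₖ |L_bk| wₖ`. -/
def rad (k : LK) (l : NL) : ℕ :=
  Nat.add (Nat.add (Nat.add (Nat.mul l.m00 k.w0) (Nat.mul l.m11 k.w1)) (Nat.mul l.m22 k.w2))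
    (Nat.add (Nat.add (Nat.mul l.m01 k.w3) (Nat.mul l.m02 k.w4)) (Nat.mul l.m12 k.w5))

/-- Step 4: accumulate the row's data for this label (`δ = q0 − t ≥ 0`, `r` the radius). -/
def step4 (a : Acc) (l : NL) (r : ℕ) (row : Row) (δ : ℕ) : Acc :=
  ⟨a.ok, addP row.sV row.aV a.vP, addN row.sV row.aV a.vN,
   addP row.sD (Nat.mul row.aD δ) a.dP, addN row.sD (Nat.mul row.aD δ) a.dN, Nat.add a.sd δ,
   addP row.sD (Nat.mul row.aD l.m00) a.g0P, addN row.sD (Nat.mul row.aD l.m00) a.g0N,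
   addP row.sD (Nat.mul row.aD l.m11) a.g1P, addN row.sD (Nat.mul row.aD l.m11) a.g1N,
   addP row.sD (Nat.mul row.aD l.m22) a.g2P, addN row.sD (Nat.mul row.aD l.m22) a.g2N,
   addP (sx row.sD l.s01) (Nat.mul row.aD l.m01) a.g3P, addN (sx row.sD l.s01) (Nat.mul row.aD l.m01) a.g3N,
   addP (sx row.sD l.s02) (Nat.mul row.aD l.m02) a.g4P, addN (sx row.sD l.s02) (Nat.mul row.aD l.m02) a.g4N,
   addP (sx row.sD l.s12) (Nat.mul row.aD l.m12) a.g5P, addN (sx row.sD l.s12) (Nat.mul row.aD l.m12) a.g5N,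
   Nat.add a.cur (Nat.mul row.M (Nat.mul (Nat.add δ r) (Nat.add δ r)))⟩

/-- Step 3: the looked-up row must cover the label's range `[q0 − r, q0 + r]` and lie left of `q0`. -/
def step3 (a : Acc) (l : NL) (q r : ℕ) : Option Row → Acc
  | none => a.fail
  | some row =>
    match Nat.ble row.A (Nat.sub q r) && Nat.ble (Nat.add q r) row.B && Nat.ble row.t q with
    | true => step4 a l r row (Nat.sub q row.t)
    | false => a.fail

/-- Step 2: a label whose whole range lies beyond `81/4` is FAR for this box (contributes `0`); otherwise look it up. -/
def step2 (tab : QT) (a : Acc) (l : NL) (q r : ℕ) : Acc :=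
  match Nat.ble (Nat.mul 81 SCN) (Nat.mul 4 (Nat.sub q r)) with
  | true => a
  | false => step3 a l q r (QT.findLE q tab none)

/-- Step 1: `q0 = qPos − qNeg` must be a natural number at least `r`. -/
def step1 (tab : QT) (a : Acc) (l : NL) (qP qN r : ℕ) : Acc :=
  match Nat.ble (Nat.add qN r) qP with
  | true => step2 tab a l (Nat.sub qP qN) r
  | false => a.fail

/-- The per-label step. -/
def step (tab : QT) (k : LK) (a : Acc) (l : NL) : Acc :=
  step1 tab a l (qPos k l) (qNeg k l) (rad k l)

/-- The fold over the near-label list (sorted by `n`), stopping at the first record with `n ≥ nstop` (all later labels are far). -/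
def foldNL (tab : QT) (k : LK) (nstop : ℕ) : Acc → List NL → Acc
  | a, [] => a
  | a, l :: ls =>
    match Nat.ble nstop l.n with
    | true => a
    | false => foldNL tab k nstop (step tab k a l) ls

/-! ## §5. The final inequality (× `SC³`) -/

/-- `|p − n|` for naturals. -/
def absDiff (p n : ℕ) : ℕ :=
  match Nat.ble n p with
  | true => Nat.sub p n
  | false => Nat.sub n p

/-- Gradient penalty `Σⱼ (|gⱼ| + E·Aⱼ)·ŵⱼ` over the six classes (`Aⱼ = Σ_labels mⱼ`, `ŵⱼ` the class-summed widths). -/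
def gradPen (E A0 A1 A2 A3 A4 A5 : ℕ) (k : LK) (a : Acc) : ℕ :=
  Nat.add (Nat.add (Nat.add (Nat.mul (Nat.add (absDiff a.g0P a.g0N) (Nat.mul E A0)) k.w0)
    (Nat.mul (Nat.add (absDiff a.g1P a.g1N) (Nat.mul E A1)) k.w1))
    (Nat.mul (Nat.add (absDiff a.g2P a.g2N) (Nat.mul E A2)) k.w2))
    (Nat.add (Nat.add (Nat.mul (Nat.add (absDiff a.g3P a.g3N) (Nat.mul E A3)) k.w3)
    (Nat.mul (Nat.add (absDiff a.g4P a.g4N) (Nat.mul E A4)) k.w4))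
    (Nat.mul (Nat.add (absDiff a.g5P a.g5N) (Nat.mul E A5)) k.w5))

/-- Left side: `μ⁺SC² + 2(SC²·vN + SC·dN + SC·E·Σδ + SC·G) + cur`. -/
def lhs (E : ℕ) (μP G : ℕ) (a : Acc) : ℕ :=
  Nat.add (Nat.add (Nat.mul μP (Nat.mul SCN SCN))
    (Nat.mul 2 (Nat.add (Nat.add (Nat.add (Nat.mul (Nat.mul SCN SCN) a.vN) (Nat.mul SCN a.dN)) (Nat.mul (Nat.mul SCN E) a.sd))
      (Nat.mul SCN G)))) a.cur

/-- Right side: `μ⁻SC² + 2(SC²·vP + SC·dP)`. -/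
def rhs (μN : ℕ) (a : Acc) : ℕ :=
  Nat.add (Nat.mul μN (Nat.mul SCN SCN)) (Nat.mul 2 (Nat.add (Nat.mul (Nat.mul SCN SCN) a.vP) (Nat.mul SCN a.dP)))

/-- Final verdict from the accumulator. -/
def final (E A0 A1 A2 A3 A4 A5 : ℕ) (k : LK) (sμ : Bool) (aμ : ℕ) (a : Acc) : Bool :=
  a.ok && Nat.ble (lhs E (addP sμ aμ 0) (gradPen E A0 A1 A2 A3 A4 A5 k a) a) (rhs (addN sμ aμ 0) a)

/-- ★ **THE v2 LEAF CHECK**: table `tab` (certified once: `tab.allOK E`), near-label list `labs` (certified once; sorted by `n`), derivative half-width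
`E`, the six class sums `Aⱼ` of the list, the stop norm `nstop` (labels with `n ≥ nstop` are far for this leaf: `36` from `‖G − 1‖ ≤ 1/4` alone), the Gram
box `g`, and the target `μ = ∓aμ` (sign bit `sμ`). -/
def leafCheck (tab : QT) (labs : List NL) (E A0 A1 A2 A3 A4 A5 nstop : ℕ) (g : GB) (sμ : Bool) (aμ : ℕ) : Bool :=
  final E A0 A1 A2 A3 A4 A5 g.toLK sμ aμ (foldNL tab g.toLK nstop acc0 labs)

end Summit.AtomisticToContinuum.Crystallization.Theorems.FrustratedLawDichotomyStrainedPatchHomLeafTableCheck
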